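import Summits.AtomisticToContinuum.Crystallization.Theses.PricedLinkCensus
import Literature.Geometry.DiscreteGeometry.FejesTothKissingTwelve
import Summits.AtomisticToContinuum.Crystallization.Theorems.PricedLinkCensusSoftLayerPropagationStubChartAssembly
import Summits.AtomisticToContinuum.Crystallization.Theorems.PricedLinkCensusSoftLayerPropagationStubLinkEdges
import Summits.AtomisticToContinuum.Crystallization.Theorems.PricedLinkCensusSoftLayerPropagationStubDevelopHO
import Summits.AtomisticToContinuum.Crystallization.Theorems.PricedLinkCensusSoftLayerPropagationStubDevelopHXFcc
import Summits.AtomisticToContinuum.Crystallization.Theorems.PricedLinkCensusSoftLayerPropagationStubDevelopHXHcp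
import Summits.AtomisticToContinuum.Crystallization.Theorems.PricedLinkCensusSoftLayerPropagationDevelopRestReduction
import Summits.AtomisticToContinuum.Crystallization.Theorems.PricedLinkCensusSoftLayerPropagationStubDevelopH1R
import Summits.AtomisticToContinuum.Crystallization.Theorems.PricedLinkCensusSoftLayerPropagationStubSoftLinkTammes
import Summits.AtomisticToContinuum.Crystallization.Theorems.PricedLinkCensusSoftLayerPropagationStubOneStackingMap

/-!
# Skeleton — crux `PricedLinkCensus.SoftLayerPropagation` (stmt-AtomisticToContinuum-14233),
# line `Sketch` v7 (exact charts + graph-ball development + MAP engine + one tracking theorem)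

Line lead: prover-line-stmt-AtomisticToContinuum-14233-0; continuation leads c1, c2, c3.  The line is
ideator 3's pair of cards `shadow-crystal-exact-charts` (combinatorial half: ring numbers pin the link GRAPH,
the graph pins exact pattern LABELS, labels develop into an exact SHADOW CRYSTAL `D`, an η = 0 finite-ball
layer propagation makes the shadow Barlow on the inner ball) and `jitterbug-quotient-identities` (metric half:
with the labels GIVEN, one rigid motion tracks the sites).

History: v4 (lead c1) split `stub_develop`; v5/v6 (lead c2) LANDED the whole exact development
(`develop_HO/HX_fcc/HX_hcp/H1R`, p126443, p130655, p133351, p135147, p146307) and `stub_softLink`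
conditionally on the named fact `musinTarasov2012_tammes_thirteen` (p127877), leaving `stub_oneStacking`
(set-based η = 0 engine `13 → 7`, "mis-plumbed at radius 8", c2 ASSESSMENT §3) and `stub_metric` (sharp).
**v7 (lead c3, 2026-08-17)**: the one-stacking step is re-plumbed onto a MAP-based engine on the graph
`5`-ball (`stub_oneStackingMap`, engine radius `33/10 < √11` — the double-twin obstruction recomputed in GRAPH terms,
see its docstring), the metric half is the tracking theorem at that radius (`stub_licence`, `nn_i/6`) plus the
near-sharp inclusion of the real `3·nn_i`-ball in the Barlow shadow ball (`stub_realBall`).  No packing /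
injectivity-of-the-shadow / real-radius development is needed.  (A radius-`4` variant with the real ball discharged
by the covering radius `√2/2` of a stacking + a second tolerance `2/9` — work/SoftLayerPropagation_v7a_radius4.lean —
was KILLED by the acute-wedge twin tip: exact graph `5`-ball, both foreign grains at `√11 = 3.3166`.)

## Composition (no `sorry` outside the registered stubs)

`SoftLayerPropagation_of : SoftLayerPropagation` is proved from

* `stub_softLink`      — the twelve-point soft link theorem (= `H` of `Theorems.softFourRings_of_twelve_unit`,
  item 14234's core, VERBATIM; landed conditionally on Tammes-13, p127877);
* `stub_linkEdges`     — LANDED p90764; `stub_chartAssembly` — LANDED p87977;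
* `stub_develop`       — LANDED (composition of `develop_HO`, `develop_HX_fcc`, `develop_HX_hcp`, `develop_rest`):
  the exact development `D` on the graph `5`-ball;
* `stub_oneStackingMap` — LANDED p171740 (verified development search): one stacking on the shadow `33/10`-ball,
  surjectivity, injectivity, from the exact development of the graph `5`-ball;
* `stub_realBall`      — OPEN (metric, near-sharp): the real `3·nn_i`-ball lies in the graph `5`-ball with shadow
  within `33/10`;
* `stub_licence`       — OPEN (the sharp metric theorem, certified-numerics class): one rigid motion tracking
  the developed sites with shadow `≤ 33/10` to `nn_i/6`.

The glue below is: `nn_i > 0` at a charge-free site, scaling of Barlow stackings, and the two-way matching.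
-/

noncomputable section

namespace Summit.AtomisticToContinuum.Crystallization.Cruxes.SoftLayerPropagation.Sketch

open Literature.Geometry.DiscreteGeometry Literature.MathematicalPhysics.StatisticalMechanics

/-- Euclidean `3`-space. -/
abbrev E3 : Type := EuclideanSpace ℝ (Fin 3)

/-! ## The registered stubs (`sorry` only in the OPEN ones; signatures fully inlined)

LANDED: `stub_chartAssembly` (p87977), `stub_linkEdges` (p90764), `develop_HO` (p126443), `develop_HX_fcc`
(p130655), `develop_HX_hcp` (p133351), `develop_rest` (p135147 ∘ `develop_H1R` p146307) — their bodies below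
are the tree theorems; `stub_oneStackingMap` LANDED p171740 (wave 1 of v7).  OPEN: `stub_softLink` (conditional landed),
`stub_realBall`, `stub_licence`. -/

/-- **stub_softLink** (13 points, analytic; CONDITIONAL VERSION LANDED p127877: `Theorems.stub_softLink_of_tammes13 :
musinTarasov2012_tammes_thirteen → stub_softLink` — the named Literature fact (Tammes `N = 13`, Musin–Tarasov 2012) is the only
open debt of item 14234; = `H` of `Theorems.softFourRings_of_twelve_unit`,
item `SoftFourRings` 14234 in twelve-point form).  Twelve points `z j` with `1 ≤ ‖z j‖ ≤ (1+η) min 1 (n j)`,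
`n j ≤ ‖z j‖`, `n j ≤ dist (z j) (z k)` (`j ≠ k`) and soft link `4`-regular: some rotated FCC/HCP
pattern has every point within `1/4` of some `z j`. -/
theorem stub_softLink : ∀ η : ℝ, 0 < η → η ≤ 1 / 100 →
      ∀ (z : Fin 12 → EuclideanSpace ℝ (Fin 3)) (n : Fin 12 → ℝ),
        (∀ j, 1 ≤ ‖z j‖) →
        (∀ j, ‖z j‖ ≤ (1 + η) * min 1 (n j)) →
        (∀ j, n j ≤ ‖z j‖) →
        (∀ j k, j ≠ k → n j ≤ dist (z j) (z k)) →
        (∀ j, (Finset.univ.filter (fun k : Fin 12 =>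
            k ≠ j ∧ dist (z j) (z k) ≤ (1 + η) * min (n j) (n k))).card = 4) →
        ∃ (A : EuclideanSpace ℝ (Fin 3) →ₗᵢ[ℝ] EuclideanSpace ℝ (Fin 3))
          (P : Finset (EuclideanSpace ℝ (Fin 3))),
          (P = Literature.Geometry.DiscreteGeometry.fccKissingPattern ∨
            P = Literature.Geometry.DiscreteGeometry.hcpKissingPattern) ∧
            ∀ p ∈ P, ∃ j : Fin 12, dist (z j) (A p) ≤ 1 / 4 := by
  sorry

/-- **stub_linkEdges** (13 points, analytic).  In the situation of `stub_softLink`, once a rotated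
pattern `A P` is `1/4`-matched to the twelve points, two BONDED points are matched to pattern
points at distance exactly `1` (pattern-adjacent): no bond of the soft link runs along a square
diagonal (`√2`) of the pattern (all longer pattern distances are excluded by the triangle
inequality alone). -/
theorem stub_linkEdges : ∀ η : ℝ, 0 < η → η ≤ 1 / 100 →
      ∀ (z : Fin 12 → EuclideanSpace ℝ (Fin 3)) (n : Fin 12 → ℝ),
        (∀ j, 1 ≤ ‖z j‖) →
        (∀ j, ‖z j‖ ≤ (1 + η) * min 1 (n j)) →
        (∀ j, n j ≤ ‖z j‖) →
        (∀ j k, j ≠ k → n j ≤ dist (z j) (z k)) →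
        (∀ j, (Finset.univ.filter (fun k : Fin 12 =>
            k ≠ j ∧ dist (z j) (z k) ≤ (1 + η) * min (n j) (n k))).card = 4) →
        ∀ (A : EuclideanSpace ℝ (Fin 3) →ₗᵢ[ℝ] EuclideanSpace ℝ (Fin 3))
          (P : Finset (EuclideanSpace ℝ (Fin 3))),
          (P = Literature.Geometry.DiscreteGeometry.fccKissingPattern ∨
            P = Literature.Geometry.DiscreteGeometry.hcpKissingPattern) →
          (∀ p ∈ P, ∃ j : Fin 12, dist (z j) (A p) ≤ 1 / 4) →
          ∀ p ∈ P, ∀ q ∈ P, ∀ j k : Fin 12,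
            dist (z j) (A p) ≤ 1 / 4 → dist (z k) (A q) ≤ 1 / 4 → j ≠ k →
            dist (z j) (z k) ≤ (1 + η) * min (n j) (n k) → dist p q = 1 := by
  exact Summit.AtomisticToContinuum.Crystallization.Theorems.stub_linkEdges

/-- **stub_chartAssembly** (bookkeeping).  The two twelve-point statements give, at every
charge-free site `j` of positive scale, an exact labelled CHART: a pattern `P` (FCC or HCP), a
linear isometry `A` and labels `m : pattern point ↦ site` with `m p` a bond-neighbour of `j` within
`nn_j/4` of `y j + nn_j • A p`, `m` injective on `P`, bonds between labelled sites exactly the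
pattern contacts (`dist p q = 1`), and every bond-neighbour of `j` labelled.  (Enumerate the twelve
neighbours, normalise `y j = 0`, `nn_j = 1` as in `Theorems.softFourRings_of_twelve(_unit)`;
injectivity since pattern points are `≥ 1` apart and `1/4 + 1/4 < 1 ≤` the separation of sites;
`→` of the graph isomorphism is `stub_linkEdges`, `←` and surjectivity by counting degrees `4`/`12`.) -/
theorem stub_chartAssembly :
    (∀ η : ℝ, 0 < η → η ≤ 1 / 100 →
      ∀ (z : Fin 12 → EuclideanSpace ℝ (Fin 3)) (n : Fin 12 → ℝ),
        (∀ j, 1 ≤ ‖z j‖) →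
        (∀ j, ‖z j‖ ≤ (1 + η) * min 1 (n j)) →
        (∀ j, n j ≤ ‖z j‖) →
        (∀ j k, j ≠ k → n j ≤ dist (z j) (z k)) →
        (∀ j, (Finset.univ.filter (fun k : Fin 12 =>
            k ≠ j ∧ dist (z j) (z k) ≤ (1 + η) * min (n j) (n k))).card = 4) →
        ∃ (A : EuclideanSpace ℝ (Fin 3) →ₗᵢ[ℝ] EuclideanSpace ℝ (Fin 3))
          (P : Finset (EuclideanSpace ℝ (Fin 3))),
          (P = Literature.Geometry.DiscreteGeometry.fccKissingPattern ∨
            P = Literature.Geometry.DiscreteGeometry.hcpKissingPattern) ∧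
            ∀ p ∈ P, ∃ j : Fin 12, dist (z j) (A p) ≤ 1 / 4) →
    (∀ η : ℝ, 0 < η → η ≤ 1 / 100 →
      ∀ (z : Fin 12 → EuclideanSpace ℝ (Fin 3)) (n : Fin 12 → ℝ),
        (∀ j, 1 ≤ ‖z j‖) →
        (∀ j, ‖z j‖ ≤ (1 + η) * min 1 (n j)) →
        (∀ j, n j ≤ ‖z j‖) →
        (∀ j k, j ≠ k → n j ≤ dist (z j) (z k)) →
        (∀ j, (Finset.univ.filter (fun k : Fin 12 =>
            k ≠ j ∧ dist (z j) (z k) ≤ (1 + η) * min (n j) (n k))).card = 4) →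
        ∀ (A : EuclideanSpace ℝ (Fin 3) →ₗᵢ[ℝ] EuclideanSpace ℝ (Fin 3))
          (P : Finset (EuclideanSpace ℝ (Fin 3))),
          (P = Literature.Geometry.DiscreteGeometry.fccKissingPattern ∨
            P = Literature.Geometry.DiscreteGeometry.hcpKissingPattern) →
          (∀ p ∈ P, ∃ j : Fin 12, dist (z j) (A p) ≤ 1 / 4) →
          ∀ p ∈ P, ∀ q ∈ P, ∀ j k : Fin 12,
            dist (z j) (A p) ≤ 1 / 4 → dist (z k) (A q) ≤ 1 / 4 → j ≠ k →
            dist (z j) (z k) ≤ (1 + η) * min (n j) (n k) → dist p q = 1) →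
    ∀ η : ℝ, 0 < η → η ≤ 1 / 100 →
      ∀ (N : ℕ) (y : Fin N → EuclideanSpace ℝ (Fin 3)) (j : Fin N),
        Literature.Geometry.DiscreteGeometry.IsChargeFree η y j →
        0 < Literature.Geometry.DiscreteGeometry.nearestDist y j →
        ∃ (P : Finset (EuclideanSpace ℝ (Fin 3)))
          (A : EuclideanSpace ℝ (Fin 3) →ₗᵢ[ℝ] EuclideanSpace ℝ (Fin 3))
          (m : EuclideanSpace ℝ (Fin 3) → Fin N),
          (P = Literature.Geometry.DiscreteGeometry.fccKissingPattern ∨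
            P = Literature.Geometry.DiscreteGeometry.hcpKissingPattern) ∧
          (∀ p ∈ P, (Literature.Geometry.DiscreteGeometry.bondGraph η y).Adj j (m p) ∧
            dist (y (m p)) (y j + Literature.Geometry.DiscreteGeometry.nearestDist y j • A p) ≤
              Literature.Geometry.DiscreteGeometry.nearestDist y j / 4) ∧
          (∀ p ∈ P, ∀ q ∈ P, m p = m q → p = q) ∧
          (∀ p ∈ P, ∀ q ∈ P,
            ((Literature.Geometry.DiscreteGeometry.bondGraph η y).Adj (m p) (m q) ↔ dist p q = 1)) ∧
          (∀ k, (Literature.Geometry.DiscreteGeometry.bondGraph η y).Adj j k → ∃ p ∈ P, m p = k) := by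
  exact Summit.AtomisticToContinuum.Crystallization.Theorems.stub_chartAssembly

/-- **develop_HO** (registered stub; LANDED p126443 as `Theorems.develop_HO`; handedness through gauge-fixed charts).  From the charts of
`stub_chartAssembly` on the `8·nn_i`-ball one can CHOOSE chart functions `Pc, Ac, mc` (same
specification) such that for every bond `j ∼ k` of charted sites and every contact tetrahedron
`{j, k, a, b}` through it, the signed volume of the labels of `(k, a, b)` at `j` is MINUS that of the
labels of `(j, a, b)` at `k`.  Route: gauge-fix every chart to `det = +1` by precomposing with the
pattern's improper symmetry (`−id` for FCC, the reflection in the hexagonal plane `x+y+z=0` for the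
tree's HCP coordinates), then `Theorems.metric_handedness_chart` at both ends (`δ = 1/20` covers the
bond windows `[1/1.01, 1.0201]`), `det (−w₁, w₂−w₁, w₃−w₁) = −det (w₁, w₂, w₃)`, and
`|det| = 1/√2` for exact contact triples (`det3_sq_eq_half_of_contact`). -/
theorem develop_HO :
    ∀ η : ℝ, 0 < η → η ≤ 1 / 100 →
      ∀ (N : ℕ) (y : Fin N → EuclideanSpace ℝ (Fin 3)) (i : Fin N),
        0 < Literature.Geometry.DiscreteGeometry.nearestDist y i →
        (∀ j : Fin N, dist (y i) (y j) ≤ 8 * Literature.Geometry.DiscreteGeometry.nearestDist y i →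
          Literature.Geometry.DiscreteGeometry.IsChargeFree η y j) →
        (∀ j : Fin N, dist (y i) (y j) ≤ 8 * Literature.Geometry.DiscreteGeometry.nearestDist y i →
          ∃ (P : Finset (EuclideanSpace ℝ (Fin 3)))
            (A : EuclideanSpace ℝ (Fin 3) →ₗᵢ[ℝ] EuclideanSpace ℝ (Fin 3))
            (m : EuclideanSpace ℝ (Fin 3) → Fin N),
            (P = Literature.Geometry.DiscreteGeometry.fccKissingPattern ∨
              P = Literature.Geometry.DiscreteGeometry.hcpKissingPattern) ∧
            (∀ p ∈ P, (Literature.Geometry.DiscreteGeometry.bondGraph η y).Adj j (m p) ∧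
              dist (y (m p)) (y j + Literature.Geometry.DiscreteGeometry.nearestDist y j • A p) ≤
                Literature.Geometry.DiscreteGeometry.nearestDist y j / 4) ∧
            (∀ p ∈ P, ∀ q ∈ P, m p = m q → p = q) ∧
            (∀ p ∈ P, ∀ q ∈ P,
              ((Literature.Geometry.DiscreteGeometry.bondGraph η y).Adj (m p) (m q) ↔ dist p q = 1)) ∧
            (∀ l, (Literature.Geometry.DiscreteGeometry.bondGraph η y).Adj j l → ∃ p ∈ P, m p = l)) →
        ∃ (Pc : Fin N → Finset (EuclideanSpace ℝ (Fin 3)))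
          (Ac : Fin N → EuclideanSpace ℝ (Fin 3) →ₗᵢ[ℝ] EuclideanSpace ℝ (Fin 3))
          (mc : Fin N → EuclideanSpace ℝ (Fin 3) → Fin N),
          (∀ j : Fin N, dist (y i) (y j) ≤ 8 * Literature.Geometry.DiscreteGeometry.nearestDist y i →
            (Pc j = Literature.Geometry.DiscreteGeometry.fccKissingPattern ∨
              Pc j = Literature.Geometry.DiscreteGeometry.hcpKissingPattern) ∧
            (∀ p ∈ Pc j, (Literature.Geometry.DiscreteGeometry.bondGraph η y).Adj j (mc j p) ∧
              dist (y (mc j p)) (y j + Literature.Geometry.DiscreteGeometry.nearestDist y j • Ac j p) ≤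
                Literature.Geometry.DiscreteGeometry.nearestDist y j / 4) ∧
            (∀ p ∈ Pc j, ∀ q ∈ Pc j, mc j p = mc j q → p = q) ∧
            (∀ p ∈ Pc j, ∀ q ∈ Pc j,
              ((Literature.Geometry.DiscreteGeometry.bondGraph η y).Adj (mc j p) (mc j q) ↔ dist p q = 1)) ∧
            (∀ l, (Literature.Geometry.DiscreteGeometry.bondGraph η y).Adj j l → ∃ p ∈ Pc j, mc j p = l)) ∧
          (∀ j k : Fin N, dist (y i) (y j) ≤ 8 * Literature.Geometry.DiscreteGeometry.nearestDist y i →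
            dist (y i) (y k) ≤ 8 * Literature.Geometry.DiscreteGeometry.nearestDist y i → (Literature.Geometry.DiscreteGeometry.bondGraph η y).Adj j k →
            ∀ a b : Fin N, (Literature.Geometry.DiscreteGeometry.bondGraph η y).Adj j a → (Literature.Geometry.DiscreteGeometry.bondGraph η y).Adj j b → (Literature.Geometry.DiscreteGeometry.bondGraph η y).Adj k a → (Literature.Geometry.DiscreteGeometry.bondGraph η y).Adj k b → (Literature.Geometry.DiscreteGeometry.bondGraph η y).Adj a b →
            ∀ p₁ ∈ Pc j, ∀ p₂ ∈ Pc j, ∀ p₃ ∈ Pc j, mc j p₁ = k → mc j p₂ = a → mc j p₃ = b →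
            ∀ q₁ ∈ Pc k, ∀ q₂ ∈ Pc k, ∀ q₃ ∈ Pc k, mc k q₁ = j → mc k q₂ = a → mc k q₃ = b →
            Matrix.det ![WithLp.ofLp p₁, WithLp.ofLp p₂, WithLp.ofLp p₃] =
              - Matrix.det ![WithLp.ofLp q₁, WithLp.ofLp q₂, WithLp.ofLp q₃]) := by
  exact Summit.AtomisticToContinuum.Crystallization.Theorems.develop_HO

/-- **develop_HX_fcc** (registered stub; LANDED p130655 as `Theorems.develop_HX_fcc`, worker of lead c2; LOCAL NO-MERGE at an FCC-type site = hypothesis `HX` of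
`Theorems.develop_step`).  `x` charge-free with an FCC chart, everything within `5/2·nn_x` charge-free
and charted; `u, k` non-bonded neighbours of `x`, `t ∉ star(x)` bonded to both ⇒ some `c` is bonded to
`x, u, k, t`.  Cases by the label distance of `u, k` in the chart of `x`: `2` (antipodal: the charts give
`‖y_u + y_k − 2 y_x‖ ≤ nn_x/2`, so a common neighbour of `u, k` is within `< nn` of `y_x`, i.e. is `x`);
`√2` (square diagonal: `Theorems.metric_octahedron(_apex)` pins the far apex `z` of the octahedron on the
square, the hard core `dist ≥ max nn` leaves only an arc of `≈ 1°` about `z` on the circle of common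
neighbours, so `t = z` and `c` = another corner of the square); `√3` (no such `t`: the two lattice
common neighbours are `x` and a neighbour of `x`, antipodal on a circle of diameter `nn`). -/
theorem develop_HX_fcc :
    ∀ η : ℝ, 0 < η → η ≤ 1 / 100 →
      ∀ (N : ℕ) (y : Fin N → EuclideanSpace ℝ (Fin 3)) (x : Fin N),
        0 < Literature.Geometry.DiscreteGeometry.nearestDist y x →
        (∀ j : Fin N, dist (y x) (y j) ≤ 5 / 2 * Literature.Geometry.DiscreteGeometry.nearestDist y x →
          Literature.Geometry.DiscreteGeometry.IsChargeFree η y j) →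
        (∀ j : Fin N, dist (y x) (y j) ≤ 5 / 2 * Literature.Geometry.DiscreteGeometry.nearestDist y x →
          ∃ (P : Finset (EuclideanSpace ℝ (Fin 3)))
            (A : EuclideanSpace ℝ (Fin 3) →ₗᵢ[ℝ] EuclideanSpace ℝ (Fin 3))
            (m : EuclideanSpace ℝ (Fin 3) → Fin N),
            (P = Literature.Geometry.DiscreteGeometry.fccKissingPattern ∨
              P = Literature.Geometry.DiscreteGeometry.hcpKissingPattern) ∧
            (∀ p ∈ P, (Literature.Geometry.DiscreteGeometry.bondGraph η y).Adj j (m p) ∧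
              dist (y (m p)) (y j + Literature.Geometry.DiscreteGeometry.nearestDist y j • A p) ≤
                Literature.Geometry.DiscreteGeometry.nearestDist y j / 4) ∧
            (∀ p ∈ P, ∀ q ∈ P, m p = m q → p = q) ∧
            (∀ p ∈ P, ∀ q ∈ P,
              ((Literature.Geometry.DiscreteGeometry.bondGraph η y).Adj (m p) (m q) ↔ dist p q = 1)) ∧
            (∀ l, (Literature.Geometry.DiscreteGeometry.bondGraph η y).Adj j l → ∃ p ∈ P, m p = l)) →
        ∀ (A : EuclideanSpace ℝ (Fin 3) →ₗᵢ[ℝ] EuclideanSpace ℝ (Fin 3)) (m : EuclideanSpace ℝ (Fin 3) → Fin N),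
          ((Literature.Geometry.DiscreteGeometry.fccKissingPattern = Literature.Geometry.DiscreteGeometry.fccKissingPattern ∨
            Literature.Geometry.DiscreteGeometry.fccKissingPattern = Literature.Geometry.DiscreteGeometry.hcpKissingPattern) ∧
          (∀ p ∈ Literature.Geometry.DiscreteGeometry.fccKissingPattern, (Literature.Geometry.DiscreteGeometry.bondGraph η y).Adj x (m p) ∧
            dist (y (m p)) (y x + Literature.Geometry.DiscreteGeometry.nearestDist y x • A p) ≤
              Literature.Geometry.DiscreteGeometry.nearestDist y x / 4) ∧
          (∀ p ∈ Literature.Geometry.DiscreteGeometry.fccKissingPattern, ∀ q ∈ Literature.Geometry.DiscreteGeometry.fccKissingPattern, m p = m q → p = q) ∧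
          (∀ p ∈ Literature.Geometry.DiscreteGeometry.fccKissingPattern, ∀ q ∈ Literature.Geometry.DiscreteGeometry.fccKissingPattern,
            ((Literature.Geometry.DiscreteGeometry.bondGraph η y).Adj (m p) (m q) ↔ dist p q = 1)) ∧
          (∀ l, (Literature.Geometry.DiscreteGeometry.bondGraph η y).Adj x l → ∃ p ∈ Literature.Geometry.DiscreteGeometry.fccKissingPattern, m p = l)) →
        ∀ u k t : Fin N, (Literature.Geometry.DiscreteGeometry.bondGraph η y).Adj x u → (Literature.Geometry.DiscreteGeometry.bondGraph η y).Adj x k → ¬ (Literature.Geometry.DiscreteGeometry.bondGraph η y).Adj u k → u ≠ k →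
          ¬ (Literature.Geometry.DiscreteGeometry.bondGraph η y).Adj x t → x ≠ t → (Literature.Geometry.DiscreteGeometry.bondGraph η y).Adj t u → (Literature.Geometry.DiscreteGeometry.bondGraph η y).Adj t k →
          ∃ c : Fin N, (Literature.Geometry.DiscreteGeometry.bondGraph η y).Adj x c ∧ (Literature.Geometry.DiscreteGeometry.bondGraph η y).Adj u c ∧ (Literature.Geometry.DiscreteGeometry.bondGraph η y).Adj k c ∧ (Literature.Geometry.DiscreteGeometry.bondGraph η y).Adj t c := by
  exact Summit.AtomisticToContinuum.Crystallization.Theorems.develop_HX_fcc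

/-- **develop_HX_hcp** (registered stub; LANDED p133351 as `Theorems.develop_HX_hcp`, worker of lead c2; LOCAL NO-MERGE at an HCP-type site).  As `develop_HX_fcc`
with the anticuboctahedral label classes `√2, √(8/3), √3, √(11/3), 2` (`√(8/3)`: the vertical pair
through a triangle — `Theorems.metric_bipyramid(_unique)`). -/
theorem develop_HX_hcp :
    ∀ η : ℝ, 0 < η → η ≤ 1 / 100 →
      ∀ (N : ℕ) (y : Fin N → EuclideanSpace ℝ (Fin 3)) (x : Fin N),
        0 < Literature.Geometry.DiscreteGeometry.nearestDist y x →
        (∀ j : Fin N, dist (y x) (y j) ≤ 5 / 2 * Literature.Geometry.DiscreteGeometry.nearestDist y x →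
          Literature.Geometry.DiscreteGeometry.IsChargeFree η y j) →
        (∀ j : Fin N, dist (y x) (y j) ≤ 5 / 2 * Literature.Geometry.DiscreteGeometry.nearestDist y x →
          ∃ (P : Finset (EuclideanSpace ℝ (Fin 3)))
            (A : EuclideanSpace ℝ (Fin 3) →ₗᵢ[ℝ] EuclideanSpace ℝ (Fin 3))
            (m : EuclideanSpace ℝ (Fin 3) → Fin N),
            (P = Literature.Geometry.DiscreteGeometry.fccKissingPattern ∨
              P = Literature.Geometry.DiscreteGeometry.hcpKissingPattern) ∧
            (∀ p ∈ P, (Literature.Geometry.DiscreteGeometry.bondGraph η y).Adj j (m p) ∧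
              dist (y (m p)) (y j + Literature.Geometry.DiscreteGeometry.nearestDist y j • A p) ≤
                Literature.Geometry.DiscreteGeometry.nearestDist y j / 4) ∧
            (∀ p ∈ P, ∀ q ∈ P, m p = m q → p = q) ∧
            (∀ p ∈ P, ∀ q ∈ P,
              ((Literature.Geometry.DiscreteGeometry.bondGraph η y).Adj (m p) (m q) ↔ dist p q = 1)) ∧
            (∀ l, (Literature.Geometry.DiscreteGeometry.bondGraph η y).Adj j l → ∃ p ∈ P, m p = l)) →
        ∀ (A : EuclideanSpace ℝ (Fin 3) →ₗᵢ[ℝ] EuclideanSpace ℝ (Fin 3)) (m : EuclideanSpace ℝ (Fin 3) → Fin N),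
          ((Literature.Geometry.DiscreteGeometry.hcpKissingPattern = Literature.Geometry.DiscreteGeometry.fccKissingPattern ∨
            Literature.Geometry.DiscreteGeometry.hcpKissingPattern = Literature.Geometry.DiscreteGeometry.hcpKissingPattern) ∧
          (∀ p ∈ Literature.Geometry.DiscreteGeometry.hcpKissingPattern, (Literature.Geometry.DiscreteGeometry.bondGraph η y).Adj x (m p) ∧
            dist (y (m p)) (y x + Literature.Geometry.DiscreteGeometry.nearestDist y x • A p) ≤
              Literature.Geometry.DiscreteGeometry.nearestDist y x / 4) ∧
          (∀ p ∈ Literature.Geometry.DiscreteGeometry.hcpKissingPattern, ∀ q ∈ Literature.Geometry.DiscreteGeometry.hcpKissingPattern, m p = m q → p = q) ∧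
          (∀ p ∈ Literature.Geometry.DiscreteGeometry.hcpKissingPattern, ∀ q ∈ Literature.Geometry.DiscreteGeometry.hcpKissingPattern,
            ((Literature.Geometry.DiscreteGeometry.bondGraph η y).Adj (m p) (m q) ↔ dist p q = 1)) ∧
          (∀ l, (Literature.Geometry.DiscreteGeometry.bondGraph η y).Adj x l → ∃ p ∈ Literature.Geometry.DiscreteGeometry.hcpKissingPattern, m p = l)) →
        ∀ u k t : Fin N, (Literature.Geometry.DiscreteGeometry.bondGraph η y).Adj x u → (Literature.Geometry.DiscreteGeometry.bondGraph η y).Adj x k → ¬ (Literature.Geometry.DiscreteGeometry.bondGraph η y).Adj u k → u ≠ k →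
          ¬ (Literature.Geometry.DiscreteGeometry.bondGraph η y).Adj x t → x ≠ t → (Literature.Geometry.DiscreteGeometry.bondGraph η y).Adj t u → (Literature.Geometry.DiscreteGeometry.bondGraph η y).Adj t k →
          ∃ c : Fin N, (Literature.Geometry.DiscreteGeometry.bondGraph η y).Adj x c ∧ (Literature.Geometry.DiscreteGeometry.bondGraph η y).Adj u c ∧ (Literature.Geometry.DiscreteGeometry.bondGraph η y).Adj k c ∧ (Literature.Geometry.DiscreteGeometry.bondGraph η y).Adj t c := by
  exact Summit.AtomisticToContinuum.Crystallization.Theorems.develop_HX_hcp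

/-- **develop_H1R** (registered stub; LANDED p146307 as `Theorems.develop_H1R`, wave-3 worker of lead c2, 2026-08-17, with 44 helper files `…H1R*.lean`; v5: the last open piece of the development; the metric
ORDERED-CAPS lemma, hypothesis `H1R` of `Theorems.develop_rest_of_orderedCaps`, p135147).  At a site `u` with
`dist (y i) (y u) + (8/3) nn_u ≤ 8 nn_i` (so everything within `(8/3) nn_u` of `u` is charge-free and charted), if
`u ~ t ~ k`, `u ≁ k`, `u ≠ k`, and, measured from `y i`, `k` is not farther than `u` by more than `(11/200) nn_u` and
`t` is not nearer than `u` by more than `(3/100) nn_u`, then some bond-neighbour `c` of `u`, nearer to `y i` than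
`u` by MORE than `(3/100) nn_u`, is bonded to `t` or to `k`.  Numerics (worker of develop_rest): on ideal Barlow
clusters (8 Hägg words, 672 types `(t,k)`, observer in every direction at `0.95 ≤ r ≤ 6.6`) the best candidate among
the ring of `{u,t}` ∪ the common neighbours of `{u,k}` (∪ the far apex of the coned square for the `√2` types) is
nearer by `≥ 0.336 nn`; with premises relaxed by `ε = 0.05/0.10/0.15/0.20` the margin is `0.30/0.29/0.24/0.21`; so it
closes once the cluster `{u,t,k,candidates}` (diameter ≤ 2.1 nn) is pinned to `≲ 0.17 nn` per site up to a rigid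
motion — true deviations are `≈ 0.03–0.06 nn`, the landed octahedron identity gives `0.13–0.20 nn`: what is missing
is a sharper small-cluster rigidity lemma (tetrahedron-on-octahedron-face / rhombus flatness). -/
theorem develop_H1R : ∀ η : ℝ, 0 < η → η ≤ 1 / 100 → ∀ (N : ℕ) (y : Fin N → EuclideanSpace ℝ (Fin 3)) (i : Fin N), 0 < nearestDist y i → (∀ j : Fin N, dist (y i) (y j) ≤ 8 * nearestDist y i → IsChargeFree η y j) → (∀ j : Fin N, dist (y i) (y j) ≤ 8 * nearestDist y i → ∃ (P : Finset (EuclideanSpace ℝ (Fin 3))) (A : EuclideanSpace ℝ (Fin 3) →ₗᵢ[ℝ] EuclideanSpace ℝ (Fin 3)) (m : EuclideanSpace ℝ (Fin 3) → Fin N), (P = fccKissingPattern ∨ P = hcpKissingPattern) ∧ (∀ p ∈ P, (bondGraph η y).Adj j (m p) ∧ dist (y (m p)) (y j + nearestDist y j • A p) ≤ nearestDist y j / 4) ∧ (∀ p ∈ P, ∀ q ∈ P, m p = m q → p = q) ∧ (∀ p ∈ P, ∀ q ∈ P, ((bondGraph η y).Adj (m p) (m q) ↔ dist p q = 1)) ∧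 (∀ k, (bondGraph η y).Adj j k → ∃ p ∈ P, m p = k)) → ∀ u t k : Fin N, dist (y i) (y u) + 8 / 3 * nearestDist y u ≤ 8 * nearestDist y i → (bondGraph η y).Adj u t → (bondGraph η y).Adj t k → ¬ (bondGraph η y).Adj u k → u ≠ k → dist (y i) (y k) ≤ dist (y i) (y u) + 11 / 200 * nearestDist y u → dist (y i) (y u) ≤ dist (y i) (y t) + 3 / 100 * nearestDist y u → ∃ c : Fin N, (bondGraph η y).Adj u c ∧ dist (y i) (y c) + 3 / 100 * nearestDist y u < dist (y i) (y u) ∧ ((bondGraph η y).Adj c t ∨ (bondGraph η y).Adj c k) := by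
  exact Summit.AtomisticToContinuum.Crystallization.Theorems.develop_H1R

/-- **develop_rest** (registered stub; v5: PROVED from `develop_H1R` by `Theorems.develop_rest_of_orderedCaps`, p135147, with the
penalised radial potential `f v = dist (y i) (y v) + (8/3) max 0 (nn_v − (53/50) nn_i)`, `R₁ = (129/25) nn_i`, `R₂ = 8 nn_i`; the REMAINDER of the development after `develop_HO` and the two
no-merge lemmas): choose the gauge-fixed charts, take `f = dist (y i) ·`, `R₁ = 26/5·nn_i ⊇` the graph
`5`-ball (`Theorems.develop_reach`), `R₂ = 8 nn_i`; supply `hnbr` (scale coherence by a greedy walk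
through the charts: pattern covering radius `45°`), `H1` (ordered caps: lattice margin `≥ 0.21·nn` for
every observer direction up to `r = 6.6`, so it needs cluster precision `≲ 0.1·nn` — octahedron-level,
sharper than the bipyramid constant `5.2α`), derive `HX` in scope from the two local lemmas, and call
`Theorems.develop_reduction`. -/
theorem develop_rest :
    (∀ η : ℝ, 0 < η → η ≤ 1 / 100 →
      ∀ (N : ℕ) (y : Fin N → EuclideanSpace ℝ (Fin 3)) (i : Fin N),
        0 < Literature.Geometry.DiscreteGeometry.nearestDist y i →
        (∀ j : Fin N, dist (y i) (y j) ≤ 8 * Literature.Geometry.DiscreteGeometry.nearestDist y i →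
          Literature.Geometry.DiscreteGeometry.IsChargeFree η y j) →
        (∀ j : Fin N, dist (y i) (y j) ≤ 8 * Literature.Geometry.DiscreteGeometry.nearestDist y i →
          ∃ (P : Finset (EuclideanSpace ℝ (Fin 3)))
            (A : EuclideanSpace ℝ (Fin 3) →ₗᵢ[ℝ] EuclideanSpace ℝ (Fin 3))
            (m : EuclideanSpace ℝ (Fin 3) → Fin N),
            (P = Literature.Geometry.DiscreteGeometry.fccKissingPattern ∨
              P = Literature.Geometry.DiscreteGeometry.hcpKissingPattern) ∧
            (∀ p ∈ P, (Literature.Geometry.DiscreteGeometry.bondGraph η y).Adj j (m p) ∧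
              dist (y (m p)) (y j + Literature.Geometry.DiscreteGeometry.nearestDist y j • A p) ≤
                Literature.Geometry.DiscreteGeometry.nearestDist y j / 4) ∧
            (∀ p ∈ P, ∀ q ∈ P, m p = m q → p = q) ∧
            (∀ p ∈ P, ∀ q ∈ P,
              ((Literature.Geometry.DiscreteGeometry.bondGraph η y).Adj (m p) (m q) ↔ dist p q = 1)) ∧
            (∀ l, (Literature.Geometry.DiscreteGeometry.bondGraph η y).Adj j l → ∃ p ∈ P, m p = l)) →
        ∃ (Pc : Fin N → Finset (EuclideanSpace ℝ (Fin 3)))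
          (Ac : Fin N → EuclideanSpace ℝ (Fin 3) →ₗᵢ[ℝ] EuclideanSpace ℝ (Fin 3))
          (mc : Fin N → EuclideanSpace ℝ (Fin 3) → Fin N),
          (∀ j : Fin N, dist (y i) (y j) ≤ 8 * Literature.Geometry.DiscreteGeometry.nearestDist y i →
            (Pc j = Literature.Geometry.DiscreteGeometry.fccKissingPattern ∨
              Pc j = Literature.Geometry.DiscreteGeometry.hcpKissingPattern) ∧
            (∀ p ∈ Pc j, (Literature.Geometry.DiscreteGeometry.bondGraph η y).Adj j (mc j p) ∧
              dist (y (mc j p)) (y j + Literature.Geometry.DiscreteGeometry.nearestDist y j • Ac j p) ≤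
                Literature.Geometry.DiscreteGeometry.nearestDist y j / 4) ∧
            (∀ p ∈ Pc j, ∀ q ∈ Pc j, mc j p = mc j q → p = q) ∧
            (∀ p ∈ Pc j, ∀ q ∈ Pc j,
              ((Literature.Geometry.DiscreteGeometry.bondGraph η y).Adj (mc j p) (mc j q) ↔ dist p q = 1)) ∧
            (∀ l, (Literature.Geometry.DiscreteGeometry.bondGraph η y).Adj j l → ∃ p ∈ Pc j, mc j p = l)) ∧
          (∀ j k : Fin N, dist (y i) (y j) ≤ 8 * Literature.Geometry.DiscreteGeometry.nearestDist y i →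
            dist (y i) (y k) ≤ 8 * Literature.Geometry.DiscreteGeometry.nearestDist y i → (Literature.Geometry.DiscreteGeometry.bondGraph η y).Adj j k →
            ∀ a b : Fin N, (Literature.Geometry.DiscreteGeometry.bondGraph η y).Adj j a → (Literature.Geometry.DiscreteGeometry.bondGraph η y).Adj j b → (Literature.Geometry.DiscreteGeometry.bondGraph η y).Adj k a → (Literature.Geometry.DiscreteGeometry.bondGraph η y).Adj k b → (Literature.Geometry.DiscreteGeometry.bondGraph η y).Adj a b →
            ∀ p₁ ∈ Pc j, ∀ p₂ ∈ Pc j, ∀ p₃ ∈ Pc j, mc j p₁ = k → mc j p₂ = a → mc j p₃ = b →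
            ∀ q₁ ∈ Pc k, ∀ q₂ ∈ Pc k, ∀ q₃ ∈ Pc k, mc k q₁ = j → mc k q₂ = a → mc k q₃ = b →
            Matrix.det ![WithLp.ofLp p₁, WithLp.ofLp p₂, WithLp.ofLp p₃] =
              - Matrix.det ![WithLp.ofLp q₁, WithLp.ofLp q₂, WithLp.ofLp q₃])) →
    (∀ η : ℝ, 0 < η → η ≤ 1 / 100 →
      ∀ (N : ℕ) (y : Fin N → EuclideanSpace ℝ (Fin 3)) (x : Fin N),
        0 < Literature.Geometry.DiscreteGeometry.nearestDist y x →
        (∀ j : Fin N, dist (y x) (y j) ≤ 5 / 2 * Literature.Geometry.DiscreteGeometry.nearestDist y x →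
          Literature.Geometry.DiscreteGeometry.IsChargeFree η y j) →
        (∀ j : Fin N, dist (y x) (y j) ≤ 5 / 2 * Literature.Geometry.DiscreteGeometry.nearestDist y x →
          ∃ (P : Finset (EuclideanSpace ℝ (Fin 3)))
            (A : EuclideanSpace ℝ (Fin 3) →ₗᵢ[ℝ] EuclideanSpace ℝ (Fin 3))
            (m : EuclideanSpace ℝ (Fin 3) → Fin N),
            (P = Literature.Geometry.DiscreteGeometry.fccKissingPattern ∨
              P = Literature.Geometry.DiscreteGeometry.hcpKissingPattern) ∧
            (∀ p ∈ P, (Literature.Geometry.DiscreteGeometry.bondGraph η y).Adj j (m p) ∧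
              dist (y (m p)) (y j + Literature.Geometry.DiscreteGeometry.nearestDist y j • A p) ≤
                Literature.Geometry.DiscreteGeometry.nearestDist y j / 4) ∧
            (∀ p ∈ P, ∀ q ∈ P, m p = m q → p = q) ∧
            (∀ p ∈ P, ∀ q ∈ P,
              ((Literature.Geometry.DiscreteGeometry.bondGraph η y).Adj (m p) (m q) ↔ dist p q = 1)) ∧
            (∀ l, (Literature.Geometry.DiscreteGeometry.bondGraph η y).Adj j l → ∃ p ∈ P, m p = l)) →
        ∀ (A : EuclideanSpace ℝ (Fin 3) →ₗᵢ[ℝ] EuclideanSpace ℝ (Fin 3)) (m : EuclideanSpace ℝ (Fin 3) → Fin N),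
          ((Literature.Geometry.DiscreteGeometry.fccKissingPattern = Literature.Geometry.DiscreteGeometry.fccKissingPattern ∨
            Literature.Geometry.DiscreteGeometry.fccKissingPattern = Literature.Geometry.DiscreteGeometry.hcpKissingPattern) ∧
          (∀ p ∈ Literature.Geometry.DiscreteGeometry.fccKissingPattern, (Literature.Geometry.DiscreteGeometry.bondGraph η y).Adj x (m p) ∧
            dist (y (m p)) (y x + Literature.Geometry.DiscreteGeometry.nearestDist y x • A p) ≤
              Literature.Geometry.DiscreteGeometry.nearestDist y x / 4) ∧
          (∀ p ∈ Literature.Geometry.DiscreteGeometry.fccKissingPattern, ∀ q ∈ Literature.Geometry.DiscreteGeometry.fccKissingPattern, m p = m q → p = q) ∧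
          (∀ p ∈ Literature.Geometry.DiscreteGeometry.fccKissingPattern, ∀ q ∈ Literature.Geometry.DiscreteGeometry.fccKissingPattern,
            ((Literature.Geometry.DiscreteGeometry.bondGraph η y).Adj (m p) (m q) ↔ dist p q = 1)) ∧
          (∀ l, (Literature.Geometry.DiscreteGeometry.bondGraph η y).Adj x l → ∃ p ∈ Literature.Geometry.DiscreteGeometry.fccKissingPattern, m p = l)) →
        ∀ u k t : Fin N, (Literature.Geometry.DiscreteGeometry.bondGraph η y).Adj x u → (Literature.Geometry.DiscreteGeometry.bondGraph η y).Adj x k → ¬ (Literature.Geometry.DiscreteGeometry.bondGraph η y).Adj u k → u ≠ k →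
          ¬ (Literature.Geometry.DiscreteGeometry.bondGraph η y).Adj x t → x ≠ t → (Literature.Geometry.DiscreteGeometry.bondGraph η y).Adj t u → (Literature.Geometry.DiscreteGeometry.bondGraph η y).Adj t k →
          ∃ c : Fin N, (Literature.Geometry.DiscreteGeometry.bondGraph η y).Adj x c ∧ (Literature.Geometry.DiscreteGeometry.bondGraph η y).Adj u c ∧ (Literature.Geometry.DiscreteGeometry.bondGraph η y).Adj k c ∧ (Literature.Geometry.DiscreteGeometry.bondGraph η y).Adj t c) →
    (∀ η : ℝ, 0 < η → η ≤ 1 / 100 →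
      ∀ (N : ℕ) (y : Fin N → EuclideanSpace ℝ (Fin 3)) (x : Fin N),
        0 < Literature.Geometry.DiscreteGeometry.nearestDist y x →
        (∀ j : Fin N, dist (y x) (y j) ≤ 5 / 2 * Literature.Geometry.DiscreteGeometry.nearestDist y x →
          Literature.Geometry.DiscreteGeometry.IsChargeFree η y j) →
        (∀ j : Fin N, dist (y x) (y j) ≤ 5 / 2 * Literature.Geometry.DiscreteGeometry.nearestDist y x →
          ∃ (P : Finset (EuclideanSpace ℝ (Fin 3)))
            (A : EuclideanSpace ℝ (Fin 3) →ₗᵢ[ℝ] EuclideanSpace ℝ (Fin 3))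
            (m : EuclideanSpace ℝ (Fin 3) → Fin N),
            (P = Literature.Geometry.DiscreteGeometry.fccKissingPattern ∨
              P = Literature.Geometry.DiscreteGeometry.hcpKissingPattern) ∧
            (∀ p ∈ P, (Literature.Geometry.DiscreteGeometry.bondGraph η y).Adj j (m p) ∧
              dist (y (m p)) (y j + Literature.Geometry.DiscreteGeometry.nearestDist y j • A p) ≤
                Literature.Geometry.DiscreteGeometry.nearestDist y j / 4) ∧
            (∀ p ∈ P, ∀ q ∈ P, m p = m q → p = q) ∧
            (∀ p ∈ P, ∀ q ∈ P,
              ((Literature.Geometry.DiscreteGeometry.bondGraph η y).Adj (m p) (m q) ↔ dist p q = 1)) ∧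
            (∀ l, (Literature.Geometry.DiscreteGeometry.bondGraph η y).Adj j l → ∃ p ∈ P, m p = l)) →
        ∀ (A : EuclideanSpace ℝ (Fin 3) →ₗᵢ[ℝ] EuclideanSpace ℝ (Fin 3)) (m : EuclideanSpace ℝ (Fin 3) → Fin N),
          ((Literature.Geometry.DiscreteGeometry.hcpKissingPattern = Literature.Geometry.DiscreteGeometry.fccKissingPattern ∨
            Literature.Geometry.DiscreteGeometry.hcpKissingPattern = Literature.Geometry.DiscreteGeometry.hcpKissingPattern) ∧
          (∀ p ∈ Literature.Geometry.DiscreteGeometry.hcpKissingPattern, (Literature.Geometry.DiscreteGeometry.bondGraph η y).Adj x (m p) ∧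
            dist (y (m p)) (y x + Literature.Geometry.DiscreteGeometry.nearestDist y x • A p) ≤
              Literature.Geometry.DiscreteGeometry.nearestDist y x / 4) ∧
          (∀ p ∈ Literature.Geometry.DiscreteGeometry.hcpKissingPattern, ∀ q ∈ Literature.Geometry.DiscreteGeometry.hcpKissingPattern, m p = m q → p = q) ∧
          (∀ p ∈ Literature.Geometry.DiscreteGeometry.hcpKissingPattern, ∀ q ∈ Literature.Geometry.DiscreteGeometry.hcpKissingPattern,
            ((Literature.Geometry.DiscreteGeometry.bondGraph η y).Adj (m p) (m q) ↔ dist p q = 1)) ∧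
          (∀ l, (Literature.Geometry.DiscreteGeometry.bondGraph η y).Adj x l → ∃ p ∈ Literature.Geometry.DiscreteGeometry.hcpKissingPattern, m p = l)) →
        ∀ u k t : Fin N, (Literature.Geometry.DiscreteGeometry.bondGraph η y).Adj x u → (Literature.Geometry.DiscreteGeometry.bondGraph η y).Adj x k → ¬ (Literature.Geometry.DiscreteGeometry.bondGraph η y).Adj u k → u ≠ k →
          ¬ (Literature.Geometry.DiscreteGeometry.bondGraph η y).Adj x t → x ≠ t → (Literature.Geometry.DiscreteGeometry.bondGraph η y).Adj t u → (Literature.Geometry.DiscreteGeometry.bondGraph η y).Adj t k →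
          ∃ c : Fin N, (Literature.Geometry.DiscreteGeometry.bondGraph η y).Adj x c ∧ (Literature.Geometry.DiscreteGeometry.bondGraph η y).Adj u c ∧ (Literature.Geometry.DiscreteGeometry.bondGraph η y).Adj k c ∧ (Literature.Geometry.DiscreteGeometry.bondGraph η y).Adj t c) →
    ∀ η : ℝ, 0 < η → η ≤ 1 / 100 →
      ∀ (N : ℕ) (y : Fin N → EuclideanSpace ℝ (Fin 3)) (i : Fin N),
        0 < Literature.Geometry.DiscreteGeometry.nearestDist y i →
        (∀ j : Fin N, dist (y i) (y j) ≤ 8 * Literature.Geometry.DiscreteGeometry.nearestDist y i →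
          Literature.Geometry.DiscreteGeometry.IsChargeFree η y j) →
        (∀ j : Fin N, dist (y i) (y j) ≤ 8 * Literature.Geometry.DiscreteGeometry.nearestDist y i →
          ∃ (P : Finset (EuclideanSpace ℝ (Fin 3)))
            (A : EuclideanSpace ℝ (Fin 3) →ₗᵢ[ℝ] EuclideanSpace ℝ (Fin 3))
            (m : EuclideanSpace ℝ (Fin 3) → Fin N),
            (P = Literature.Geometry.DiscreteGeometry.fccKissingPattern ∨
              P = Literature.Geometry.DiscreteGeometry.hcpKissingPattern) ∧
            (∀ p ∈ P, (Literature.Geometry.DiscreteGeometry.bondGraph η y).Adj j (m p) ∧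
              dist (y (m p)) (y j + Literature.Geometry.DiscreteGeometry.nearestDist y j • A p) ≤
                Literature.Geometry.DiscreteGeometry.nearestDist y j / 4) ∧
            (∀ p ∈ P, ∀ q ∈ P, m p = m q → p = q) ∧
            (∀ p ∈ P, ∀ q ∈ P,
              ((Literature.Geometry.DiscreteGeometry.bondGraph η y).Adj (m p) (m q) ↔
                dist p q = 1)) ∧
            (∀ k, (Literature.Geometry.DiscreteGeometry.bondGraph η y).Adj j k → ∃ p ∈ P, m p = k)) →
        ∃ D : Fin N → EuclideanSpace ℝ (Fin 3),
          ∀ j : Fin N, (∃ w : (Literature.Geometry.DiscreteGeometry.bondGraph η y).Walk i j, w.length ≤ 5) →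
            ∃ (P : Finset (EuclideanSpace ℝ (Fin 3)))
              (Q R : EuclideanSpace ℝ (Fin 3) →ₗᵢ[ℝ] EuclideanSpace ℝ (Fin 3)),
              (P = Literature.Geometry.DiscreteGeometry.fccKissingPattern ∨
                P = Literature.Geometry.DiscreteGeometry.hcpKissingPattern) ∧
              D '' {k | (Literature.Geometry.DiscreteGeometry.bondGraph η y).Adj j k} =
                (fun p => D j + Q p) '' (P : Set (EuclideanSpace ℝ (Fin 3))) ∧
              (∀ k, (Literature.Geometry.DiscreteGeometry.bondGraph η y).Adj j k →
                ‖(y k - y j) - Literature.Geometry.DiscreteGeometry.nearestDist y j • R (D k - D j)‖ ≤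
                  Literature.Geometry.DiscreteGeometry.nearestDist y j / 4) ∧
              (∀ k k', (Literature.Geometry.DiscreteGeometry.bondGraph η y).Adj j k →
                (Literature.Geometry.DiscreteGeometry.bondGraph η y).Adj j k' →
                ((Literature.Geometry.DiscreteGeometry.bondGraph η y).Adj k k' ↔
                  dist (D k) (D k') = 1)) := by
  exact Summit.AtomisticToContinuum.Crystallization.Theorems.develop_rest_of_orderedCaps develop_H1R

/-- **stub_develop** (development of the exact shadow crystal on the GRAPH `5`-ball; v4: PROVED from the
registered stubs `develop_HO`, `develop_HX_fcc`, `develop_HX_hcp`, `develop_rest`).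
If `nn_i > 0`, every site within `8·nn_i` of `y i` is charge-free at `η ∈ (0, 1/100]` and carries
an exact labelled chart (conclusion of `stub_chartAssembly`), then there are unit-scale shadow
positions `D : Fin N → ℝ³` such that at every site `j` joined to `i` by a bond walk of length `≤ 5`
the bond-neighbours of `j` are carried by `D` EXACTLY onto a rotated FCC/HCP pattern about `D j`, the real
bond vectors are within `nn_j/4` of `nn_j •` a rotated copy of the shadow bond vectors, and bonds
among neighbours of `j` are exactly the unit distances of `D`. -/
theorem stub_develop :
    ∀ η : ℝ, 0 < η → η ≤ 1 / 100 →
      ∀ (N : ℕ) (y : Fin N → EuclideanSpace ℝ (Fin 3)) (i : Fin N),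
        0 < Literature.Geometry.DiscreteGeometry.nearestDist y i →
        (∀ j : Fin N, dist (y i) (y j) ≤ 8 * Literature.Geometry.DiscreteGeometry.nearestDist y i →
          Literature.Geometry.DiscreteGeometry.IsChargeFree η y j) →
        (∀ j : Fin N, dist (y i) (y j) ≤ 8 * Literature.Geometry.DiscreteGeometry.nearestDist y i →
          ∃ (P : Finset (EuclideanSpace ℝ (Fin 3)))
            (A : EuclideanSpace ℝ (Fin 3) →ₗᵢ[ℝ] EuclideanSpace ℝ (Fin 3))
            (m : EuclideanSpace ℝ (Fin 3) → Fin N),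
            (P = Literature.Geometry.DiscreteGeometry.fccKissingPattern ∨
              P = Literature.Geometry.DiscreteGeometry.hcpKissingPattern) ∧
            (∀ p ∈ P, (Literature.Geometry.DiscreteGeometry.bondGraph η y).Adj j (m p) ∧
              dist (y (m p)) (y j + Literature.Geometry.DiscreteGeometry.nearestDist y j • A p) ≤
                Literature.Geometry.DiscreteGeometry.nearestDist y j / 4) ∧
            (∀ p ∈ P, ∀ q ∈ P, m p = m q → p = q) ∧
            (∀ p ∈ P, ∀ q ∈ P,
              ((Literature.Geometry.DiscreteGeometry.bondGraph η y).Adj (m p) (m q) ↔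
                dist p q = 1)) ∧
            (∀ k, (Literature.Geometry.DiscreteGeometry.bondGraph η y).Adj j k → ∃ p ∈ P, m p = k)) →
        ∃ D : Fin N → EuclideanSpace ℝ (Fin 3),
          ∀ j : Fin N, (∃ w : (Literature.Geometry.DiscreteGeometry.bondGraph η y).Walk i j, w.length ≤ 5) →
            ∃ (P : Finset (EuclideanSpace ℝ (Fin 3)))
              (Q R : EuclideanSpace ℝ (Fin 3) →ₗᵢ[ℝ] EuclideanSpace ℝ (Fin 3)),
              (P = Literature.Geometry.DiscreteGeometry.fccKissingPattern ∨
                P = Literature.Geometry.DiscreteGeometry.hcpKissingPattern) ∧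
              D '' {k | (Literature.Geometry.DiscreteGeometry.bondGraph η y).Adj j k} =
                (fun p => D j + Q p) '' (P : Set (EuclideanSpace ℝ (Fin 3))) ∧
              (∀ k, (Literature.Geometry.DiscreteGeometry.bondGraph η y).Adj j k →
                ‖(y k - y j) - Literature.Geometry.DiscreteGeometry.nearestDist y j • R (D k - D j)‖ ≤
                  Literature.Geometry.DiscreteGeometry.nearestDist y j / 4) ∧
              (∀ k k', (Literature.Geometry.DiscreteGeometry.bondGraph η y).Adj j k →
                (Literature.Geometry.DiscreteGeometry.bondGraph η y).Adj j k' →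
                ((Literature.Geometry.DiscreteGeometry.bondGraph η y).Adj k k' ↔
                  dist (D k) (D k') = 1)) :=
  develop_rest develop_HO develop_HX_fcc develop_HX_hcp


/-- **stub_oneStackingMap** (v7, lead c3, 2026-08-17; LANDED p171740 by the wave-1 worker as `Theorems.stub_oneStackingMap` —
VERIFIED DEVELOPMENT SEARCH, `--computational`: 4227 exact developments of the graph 4-ball enumerated and checked at radius²
`1089/100`, 2144 of them fail at radius² `11`; 67 files `…OneStackingMap*.lean`; η = 0 in substance, MAP-based, exact and finite —
replaces v6's `stub_oneStacking`, whose set-based engine `H0` "can never be fed" at radius 8, c2 §3(a)).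
THE GRAPH-BALL ENGINE.  Given the exact development `D` on the graph `5`-ball about `i` (conclusion of
`stub_develop`: at every such site the bond-neighbours are carried EXACTLY onto a rotated FCC/HCP pattern,
bonds among them are exactly the unit shadow distances), there are a Hägg sequence `s` and a rigid motion
`φ` of shadow space such that, writing `T₅` for the graph `5`-ball and `33/10` for the engine radius:
(membership) every `j ∈ T₅` with `dist (D j) (D i) ≤ 33/10` has `φ (D j) ∈ barlowStacking 1 √(2/3) s`;
(surjectivity) every stacking point within `33/10` of `φ (D i)` is `φ (D j)` for such a `j`;
(injectivity) two such sites with the same shadow coincide.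
Why `33/10`, and why not more, from a graph `5`-ball (exact computations of this session, unit `nn`):
(a) in EVERY Barlow stacking the graph `5`-ball contains the shadow ball of radius `3√2 = 4.2426` and the
graph `4`-ball (whose sites have complete exact shells here) that of radius `√13 = 3.6056`
(work/num/inradius.py: fcc, hcp, dhcp, twins, 12 random Hägg words); (b) the exact obstruction is the
double twin (three fcc grains, two coherent Σ3 planes of the middle grain `B` meeting on a `⟨1,-1,0⟩`
junction row; disprover's `¬ SLP (14/5) 3 (1/6)`, strategist's metric staircase j023867); recomputed in
GRAPH terms (work/num/tjunction.py, tjunction2.py): with `B` in the OBTUSE wedge (109.5°) the row is reached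
along a straight bond row and no centre with an exact graph `5`-ball fails below radius `5.29` (graph
`4`-ball: `√(65/3) = 4.65`); with `B` in the ACUTE wedge (70.5°, the twin-lamella tip) the apex is reached
along the `4`-fold zig-zag, the centre `6` bonds (= `3√2` metric) up the bisector has an exact graph `5`-ball
and sees both foreign grains at EXACTLY `√11 = 3.3166` — so the engine radius must be `< √11`; `33/10` it is,
and the proof must be sharp (the extremal wedge geometry must come out exactly).
Proof plan (Hales DSP §1.3 order, on the abstract development): `h`-sites carry one hexagonal plane, which
propagates to in-plane neighbours (tree: `Literature/…/LayerShells`, `LayerPropagation` local lemmas, to be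
re-run on exact stars instead of kissing shells of a packing); two `h`-discs on non-parallel planes that both
carry foreign material inside the `33/10`-ball force a non-pattern star within graph distance `5` (the wedge
computation above is the quantitative content: junction row within `√11`-geometry); parallel `h`-discs + fcc
slabs = one stacking (tree: `LayerStackings`, landed `…StubBallPropagationStacking`); surjectivity by outward
induction over complete exact shells (graph `4`-ball ⊇ shadow `3.6`); injectivity because a site and its
ghost would have graph distance ≥ 3 yet identical exact stars inside one stacking ball. -/
theorem stub_oneStackingMap :
    ∀ η : ℝ, 0 < η → η ≤ 1 / 100 →
      ∀ (N : ℕ) (y : Fin N → EuclideanSpace ℝ (Fin 3)) (i : Fin N),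
        0 < Literature.Geometry.DiscreteGeometry.nearestDist y i →
        (∀ j : Fin N, dist (y i) (y j) ≤ 8 * Literature.Geometry.DiscreteGeometry.nearestDist y i →
          Literature.Geometry.DiscreteGeometry.IsChargeFree η y j) →
        ∀ D : Fin N → EuclideanSpace ℝ (Fin 3),
          (∀ j : Fin N, (∃ w : (Literature.Geometry.DiscreteGeometry.bondGraph η y).Walk i j, w.length ≤ 5) →
            ∃ (P : Finset (EuclideanSpace ℝ (Fin 3)))
              (Q R : EuclideanSpace ℝ (Fin 3) →ₗᵢ[ℝ] EuclideanSpace ℝ (Fin 3)),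
              (P = Literature.Geometry.DiscreteGeometry.fccKissingPattern ∨
                P = Literature.Geometry.DiscreteGeometry.hcpKissingPattern) ∧
              D '' {k | (Literature.Geometry.DiscreteGeometry.bondGraph η y).Adj j k} =
                (fun p => D j + Q p) '' (P : Set (EuclideanSpace ℝ (Fin 3))) ∧
              (∀ k, (Literature.Geometry.DiscreteGeometry.bondGraph η y).Adj j k →
                ‖(y k - y j) - Literature.Geometry.DiscreteGeometry.nearestDist y j • R (D k - D j)‖ ≤
                  Literature.Geometry.DiscreteGeometry.nearestDist y j / 4) ∧
              (∀ k k', (Literature.Geometry.DiscreteGeometry.bondGraph η y).Adj j k →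
                (Literature.Geometry.DiscreteGeometry.bondGraph η y).Adj j k' →
                ((Literature.Geometry.DiscreteGeometry.bondGraph η y).Adj k k' ↔
                  dist (D k) (D k') = 1))) →
          ∃ (s : ℤ → ℤ) (φ : EuclideanSpace ℝ (Fin 3) ≃ᵃⁱ[ℝ] EuclideanSpace ℝ (Fin 3)),
            Literature.MathematicalPhysics.StatisticalMechanics.IsHaggSeq s ∧
            (∀ j : Fin N, (∃ w : (Literature.Geometry.DiscreteGeometry.bondGraph η y).Walk i j, w.length ≤ 5) →
              dist (D j) (D i) ≤ 33 / 10 →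
              φ (D j) ∈ Literature.MathematicalPhysics.StatisticalMechanics.barlowStacking 1
                (Real.sqrt (2 / 3)) s) ∧
            (∀ z ∈ Literature.MathematicalPhysics.StatisticalMechanics.barlowStacking 1
                (Real.sqrt (2 / 3)) s,
              dist z (φ (D i)) ≤ 33 / 10 →
              ∃ j : Fin N, (∃ w : (Literature.Geometry.DiscreteGeometry.bondGraph η y).Walk i j,
                w.length ≤ 5) ∧ dist (D j) (D i) ≤ 33 / 10 ∧ φ (D j) = z) ∧
            (∀ j k : Fin N, (∃ w : (Literature.Geometry.DiscreteGeometry.bondGraph η y).Walk i j, w.length ≤ 5) →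
              (∃ w : (Literature.Geometry.DiscreteGeometry.bondGraph η y).Walk i k, w.length ≤ 5) →
              dist (D j) (D i) ≤ 33 / 10 → dist (D k) (D i) ≤ 33 / 10 → D j = D k → j = k) := by
  exact Summit.AtomisticToContinuum.Crystallization.Theorems.stub_oneStackingMap

/-- **stub_realBall** (v7; metric, one-sided but near-sharp: L+; = clause (ii) of v6's `stub_oneStacking`
with `7/2` sharpened to the engine radius `33/10`).  THE REAL BALL IS INSIDE THE BARLOW SHADOW BALL.  Given the
charge-free `8·nn_i`-ball, the exact development `D` on the graph `5`-ball and the stacking data of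
`stub_oneStackingMap` at radius `33/10`: every site `j` with `dist (y i) (y j) ≤ 3·nn_i` lies in the graph
`5`-ball and has shadow within `33/10` of `D i`.  Truth: shadow ≈ real/(mean scale) + deviation ≤ 3/0.98 + 0.08
≈ 3.14 (scale may fall 1 %/shell outward; the two-way deviation at radius 3 is ≤ 0.0715·nn in the worst
legitimate configuration, c2 METRIC-REPORT); margin ≈ 0.15·nn — NOT coarse.  Also "`j` is in the graph
`5`-ball" is a real→graph statement: descent through `1/4`-charts stalls at `1.03·nn` (fixed point of
`d ↦ √(d²+1−√2·d) + 1/4`) and Tammes-13 excludes a 13th site only out to `1.06·nn_i`, so this needs two-sided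
position tracking of the graph `5`-ball (the licence's machinery at tolerance ≈ 0.15) plus local covering by
exact second shells and hard core.  Expected to be proved together with / right after `stub_licence`. -/
theorem stub_realBall :
    ∀ η : ℝ, 0 < η → η ≤ 1 / 100 →
      ∀ (N : ℕ) (y : Fin N → EuclideanSpace ℝ (Fin 3)) (i : Fin N),
        0 < Literature.Geometry.DiscreteGeometry.nearestDist y i →
        (∀ j : Fin N, dist (y i) (y j) ≤ 8 * Literature.Geometry.DiscreteGeometry.nearestDist y i →
          Literature.Geometry.DiscreteGeometry.IsChargeFree η y j) →
        ∀ (D : Fin N → EuclideanSpace ℝ (Fin 3))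
          (φ : EuclideanSpace ℝ (Fin 3) ≃ᵃⁱ[ℝ] EuclideanSpace ℝ (Fin 3)) (s : ℤ → ℤ),
          (∀ j : Fin N, (∃ w : (Literature.Geometry.DiscreteGeometry.bondGraph η y).Walk i j, w.length ≤ 5) →
            ∃ (P : Finset (EuclideanSpace ℝ (Fin 3)))
              (Q R : EuclideanSpace ℝ (Fin 3) →ₗᵢ[ℝ] EuclideanSpace ℝ (Fin 3)),
              (P = Literature.Geometry.DiscreteGeometry.fccKissingPattern ∨
                P = Literature.Geometry.DiscreteGeometry.hcpKissingPattern) ∧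
              D '' {k | (Literature.Geometry.DiscreteGeometry.bondGraph η y).Adj j k} =
                (fun p => D j + Q p) '' (P : Set (EuclideanSpace ℝ (Fin 3))) ∧
              (∀ k, (Literature.Geometry.DiscreteGeometry.bondGraph η y).Adj j k →
                ‖(y k - y j) - Literature.Geometry.DiscreteGeometry.nearestDist y j • R (D k - D j)‖ ≤
                  Literature.Geometry.DiscreteGeometry.nearestDist y j / 4) ∧
              (∀ k k', (Literature.Geometry.DiscreteGeometry.bondGraph η y).Adj j k →
                (Literature.Geometry.DiscreteGeometry.bondGraph η y).Adj j k' →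
                ((Literature.Geometry.DiscreteGeometry.bondGraph η y).Adj k k' ↔
                  dist (D k) (D k') = 1))) →
          Literature.MathematicalPhysics.StatisticalMechanics.IsHaggSeq s →
          (∀ j : Fin N, (∃ w : (Literature.Geometry.DiscreteGeometry.bondGraph η y).Walk i j, w.length ≤ 5) →
            dist (D j) (D i) ≤ 33 / 10 →
            φ (D j) ∈ Literature.MathematicalPhysics.StatisticalMechanics.barlowStacking 1
              (Real.sqrt (2 / 3)) s) →
          (∀ z ∈ Literature.MathematicalPhysics.StatisticalMechanics.barlowStacking 1
              (Real.sqrt (2 / 3)) s,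
            dist z (φ (D i)) ≤ 33 / 10 →
            ∃ j : Fin N, (∃ w : (Literature.Geometry.DiscreteGeometry.bondGraph η y).Walk i j,
              w.length ≤ 5) ∧ dist (D j) (D i) ≤ 33 / 10 ∧ φ (D j) = z) →
          (∀ j k : Fin N, (∃ w : (Literature.Geometry.DiscreteGeometry.bondGraph η y).Walk i j, w.length ≤ 5) →
            (∃ w : (Literature.Geometry.DiscreteGeometry.bondGraph η y).Walk i k, w.length ≤ 5) →
            dist (D j) (D i) ≤ 33 / 10 → dist (D k) (D i) ≤ 33 / 10 → D j = D k → j = k) →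
          ∀ j : Fin N, dist (y i) (y j) ≤ 3 * Literature.Geometry.DiscreteGeometry.nearestDist y i →
            (∃ w : (Literature.Geometry.DiscreteGeometry.bondGraph η y).Walk i j, w.length ≤ 5) ∧
              dist (D j) (D i) ≤ 33 / 10 := by
  sorry

/-- **stub_licence** (v7; the sharp metric statement of the line = the strategist's `LabelledLicence` in
development form = v6's `stub_metric` with the labels' stacking data added as hypotheses and the radius
sharpened to the engine radius; XL, certified-numerics class, held by the lead).  THE TRACKING THEOREM.
Given `nn_i > 0`, charge-freeness at `η ∈ (0, 1/100]` within `8·nn_i`, the exact development `D` on the graph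
`5`-ball (conclusion of `stub_develop`), a Hägg sequence `s` and a rigid motion `φ` with membership,
surjectivity and injectivity at shadow radius `33/10` (conclusion of `stub_oneStackingMap`): ONE rigid motion
`g` of real space has `dist (y j) (g (nn_i • φ (D j))) ≤ nn_i/6` for every site of the graph `5`-ball with
shadow within `33/10` of `D i`.
Truth (c2 METRIC-REPORT, strategist j023877): the worst legitimate charge-free deformations are
(similarity) ∘ (Möbius with `|∇ log λ|·nn ≈ 1.3 %`) ∘ (strain `≈ 0.9 %`), two-way deviation `0.0715·nn` at
real radius `3`, `≈ 0.085` at `3.3` (Möbius part ∝ r²): factor `≈ 2`; PROVED lower bound `> 0.05` at radius `3`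
(`¬ SLP 8 3 (1/20)`, Disproof §5).  No path-sum / chained-cell proof can certify a factor `< 3` (c2 ASSESSMENT
§2: per-shell frame comparison constants would have to beat the true per-shell variation); intended proof:
rotation-invariant linearisation (squared bond lengths; per-site isotropy `max/min ≤ 1.0201`, scale coupling
through shared bonds) with a certified remainder, and an LP/SDP DUAL CERTIFICATE for the linear problem on the
labelled reference stacking (all Hägg words of the `±5` layers that matter), checked over `ℚ`. -/
theorem stub_licence :
    ∀ η : ℝ, 0 < η → η ≤ 1 / 100 →
      ∀ (N : ℕ) (y : Fin N → EuclideanSpace ℝ (Fin 3)) (i : Fin N),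
        0 < Literature.Geometry.DiscreteGeometry.nearestDist y i →
        (∀ j : Fin N, dist (y i) (y j) ≤ 8 * Literature.Geometry.DiscreteGeometry.nearestDist y i →
          Literature.Geometry.DiscreteGeometry.IsChargeFree η y j) →
        ∀ (D : Fin N → EuclideanSpace ℝ (Fin 3))
          (φ : EuclideanSpace ℝ (Fin 3) ≃ᵃⁱ[ℝ] EuclideanSpace ℝ (Fin 3)) (s : ℤ → ℤ),
          (∀ j : Fin N, (∃ w : (Literature.Geometry.DiscreteGeometry.bondGraph η y).Walk i j, w.length ≤ 5) →
            ∃ (P : Finset (EuclideanSpace ℝ (Fin 3)))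
              (Q R : EuclideanSpace ℝ (Fin 3) →ₗᵢ[ℝ] EuclideanSpace ℝ (Fin 3)),
              (P = Literature.Geometry.DiscreteGeometry.fccKissingPattern ∨
                P = Literature.Geometry.DiscreteGeometry.hcpKissingPattern) ∧
              D '' {k | (Literature.Geometry.DiscreteGeometry.bondGraph η y).Adj j k} =
                (fun p => D j + Q p) '' (P : Set (EuclideanSpace ℝ (Fin 3))) ∧
              (∀ k, (Literature.Geometry.DiscreteGeometry.bondGraph η y).Adj j k →
                ‖(y k - y j) - Literature.Geometry.DiscreteGeometry.nearestDist y j • R (D k - D j)‖ ≤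
                  Literature.Geometry.DiscreteGeometry.nearestDist y j / 4) ∧
              (∀ k k', (Literature.Geometry.DiscreteGeometry.bondGraph η y).Adj j k →
                (Literature.Geometry.DiscreteGeometry.bondGraph η y).Adj j k' →
                ((Literature.Geometry.DiscreteGeometry.bondGraph η y).Adj k k' ↔
                  dist (D k) (D k') = 1))) →
          Literature.MathematicalPhysics.StatisticalMechanics.IsHaggSeq s →
          (∀ j : Fin N, (∃ w : (Literature.Geometry.DiscreteGeometry.bondGraph η y).Walk i j, w.length ≤ 5) →
            dist (D j) (D i) ≤ 33 / 10 →
            φ (D j) ∈ Literature.MathematicalPhysics.StatisticalMechanics.barlowStacking 1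
              (Real.sqrt (2 / 3)) s) →
          (∀ z ∈ Literature.MathematicalPhysics.StatisticalMechanics.barlowStacking 1
              (Real.sqrt (2 / 3)) s,
            dist z (φ (D i)) ≤ 33 / 10 →
            ∃ j : Fin N, (∃ w : (Literature.Geometry.DiscreteGeometry.bondGraph η y).Walk i j,
              w.length ≤ 5) ∧ dist (D j) (D i) ≤ 33 / 10 ∧ φ (D j) = z) →
          (∀ j k : Fin N, (∃ w : (Literature.Geometry.DiscreteGeometry.bondGraph η y).Walk i j, w.length ≤ 5) →
            (∃ w : (Literature.Geometry.DiscreteGeometry.bondGraph η y).Walk i k, w.length ≤ 5) →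
            dist (D j) (D i) ≤ 33 / 10 → dist (D k) (D i) ≤ 33 / 10 → D j = D k → j = k) →
          ∃ g : EuclideanSpace ℝ (Fin 3) ≃ᵃⁱ[ℝ] EuclideanSpace ℝ (Fin 3),
            ∀ j : Fin N, (∃ w : (Literature.Geometry.DiscreteGeometry.bondGraph η y).Walk i j, w.length ≤ 5) →
              dist (D j) (D i) ≤ 33 / 10 →
              dist (y j) (g (Literature.Geometry.DiscreteGeometry.nearestDist y i • φ (D j))) ≤
                Literature.Geometry.DiscreteGeometry.nearestDist y i / 6 := by
  sorry

/-! ## Glue (fully proved) -/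

/-- **A charge-free site has positive scale.**  If `nn_i = 0` then the bonds of `i` are exactly the
sites coinciding with `y i` (a bond needs `dist ≤ (1+η)·min 0 nn_k = 0`); if there are twelve of
them, any one of them, `k`, has as bond-neighbours the other eleven together with `i`, so the ring
number of `{i, k}` is `11 ≠ 4`.  No sign condition on `η` is needed. -/
theorem nearestDist_pos_of_isChargeFree {N : ℕ} {η : ℝ} {y : Fin N → E3} {i : Fin N}
    (h : IsChargeFree η y i) : 0 < nearestDist y i := by
  rcases (nearestDist_nonneg y i).eq_or_lt with h0 | hpos
  · exfalso
    -- with `nn_i = 0`, the neighbours of `i` are the sites at distance `0`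
    have hN : ∀ k, k ∈ (bondGraph η y).neighborSet i ↔ k ≠ i ∧ dist (y i) (y k) = 0 := by
      intro k
      rw [mem_neighborSet_bondGraph, ← h0]
      constructor
      · rintro ⟨hne, hle⟩
        refine ⟨fun h => hne h.symm, le_antisymm (hle.trans ?_) dist_nonneg⟩
        have : min (0 : ℝ) (nearestDist y k) = 0 := min_eq_left (nearestDist_nonneg y k)
        rw [this, mul_zero]
      · rintro ⟨hne, hd⟩
        refine ⟨fun h => hne h.symm, ?_⟩
        have : min (0 : ℝ) (nearestDist y k) = 0 := min_eq_left (nearestDist_nonneg y k)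
        rw [hd, this, mul_zero]
    have hcard := h.1
    -- pick a neighbour `k`
    obtain ⟨k, hk⟩ : ((bondGraph η y).neighborSet i).Nonempty :=
      Set.nonempty_of_ncard_ne_zero (by rw [hcard]; decide)
    obtain ⟨hki, hdk⟩ := (hN k).1 hk
    -- `nn_k = 0` as well
    have hk0 : nearestDist y k = 0 := by
      refine le_antisymm ?_ (nearestDist_nonneg y k)
      have := nearestDist_le_dist y (j := k) (k := i) (fun h => hki h.symm)
      rwa [dist_comm, hdk] at this
    have hNk : ∀ m, m ∈ (bondGraph η y).neighborSet k ↔ m ≠ k ∧ dist (y k) (y m) = 0 := by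
      intro m
      rw [mem_neighborSet_bondGraph, hk0]
      constructor
      · rintro ⟨hne, hle⟩
        refine ⟨fun h => hne h.symm, le_antisymm (hle.trans ?_) dist_nonneg⟩
        have : min (0 : ℝ) (nearestDist y m) = 0 := min_eq_left (nearestDist_nonneg y m)
        rw [this, mul_zero]
      · rintro ⟨hne, hd⟩
        refine ⟨fun h => hne h.symm, ?_⟩
        have : min (0 : ℝ) (nearestDist y m) = 0 := min_eq_left (nearestDist_nonneg y m)
        rw [hd, this, mul_zero]
    -- the common neighbours of `i` and `k` are `N(i) \ {k}`
    have hinter : (bondGraph η y).neighborSet i ∩ (bondGraph η y).neighborSet k =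
        (bondGraph η y).neighborSet i \ {k} := by
      ext m
      simp only [Set.mem_inter_iff, Set.mem_sdiff, Set.mem_singleton_iff, hN, hNk]
      constructor
      · rintro ⟨⟨hmi, hdm⟩, hmk, -⟩
        exact ⟨⟨hmi, hdm⟩, hmk⟩
      · rintro ⟨⟨hmi, hdm⟩, hmk⟩
        refine ⟨⟨hmi, hdm⟩, hmk, ?_⟩
        have h1 : dist (y k) (y m) ≤ dist (y k) (y i) + dist (y i) (y m) := dist_triangle _ _ _
        rw [dist_comm (y k) (y i), hdk, hdm, zero_add] at h1
        exact le_antisymm h1 dist_nonneg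
    have hring := h.2 k hk
    rw [ringNumber_def, hinter, Set.ncard_sdiff_singleton_of_mem hk, hcard] at hring
    omega
  · exact hpos

/-- The lattice vectors scale linearly in the spacing. -/
theorem triangularVec₁_eq_smul (a : ℝ) : triangularVec₁ a = a • triangularVec₁ 1 := by
  ext l; fin_cases l <;> simp [triangularVec₁]

/-- The lattice vectors scale linearly in the spacing. -/
theorem triangularVec₂_eq_smul (a : ℝ) : triangularVec₂ a = a • triangularVec₂ 1 := by
  ext l; fin_cases l <;> simp [triangularVec₂] <;> ring

/-- The offset scales linearly in the spacing. -/
theorem barlowOffset_eq_smul (a : ℝ) : barlowOffset a = a • barlowOffset 1 := by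
  ext l; fin_cases l <;> simp [barlowOffset] <;> ring

/-- The layer normal scales linearly in the spacing. -/
theorem layerNormal_eq_smul (a c : ℝ) : layerNormal (a * c) = a • layerNormal c := by
  ext l; fin_cases l <;> simp [layerNormal]

/-- **Barlow stackings scale**: `barlowPos a (a c) s = a • barlowPos 1 c s`. -/
theorem barlowPos_eq_smul (a c : ℝ) (s : ℤ → ℤ) (k i j : ℤ) :
    barlowPos a (a * c) s k i j = a • barlowPos 1 c s k i j := by
  simp only [barlowPos, triangularVec₁_eq_smul a, triangularVec₂_eq_smul a, barlowOffset_eq_smul a,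
    layerNormal_eq_smul a c, smul_add, smul_comm _ a]

/-- **Scaling a unit Barlow stacking by `a` gives the stacking of spacing `a`.** -/
theorem smul_mem_barlowStacking {a c : ℝ} {s : ℤ → ℤ} {x : E3}
    (hx : x ∈ barlowStacking 1 c s) : a • x ∈ barlowStacking a (a * c) s := by
  obtain ⟨k, i, j, rfl⟩ := hx
  exact ⟨k, i, j, (barlowPos_eq_smul a c s k i j).symm⟩

/-- **Conversely**, every point of the stacking of spacing `a` is `a •` a point of the unit
stacking. -/
theorem exists_eq_smul_of_mem_barlowStacking {a c : ℝ} {s : ℤ → ℤ} {z : E3}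
    (hz : z ∈ barlowStacking a (a * c) s) : ∃ x ∈ barlowStacking 1 c s, z = a • x := by
  obtain ⟨k, i, j, rfl⟩ := hz
  exact ⟨barlowPos 1 c s k i j, ⟨k, i, j, rfl⟩, barlowPos_eq_smul a c s k i j⟩


/-! ## Composition (no `sorry` below this line) -/

/-- **The line closes the crux (v7).**  Charts at every charge-free site of the `8·nn_i`-ball
(`stub_chartAssembly` fed with `stub_softLink`, `stub_linkEdges`); the exact development `D` on the graph
`5`-ball (`stub_develop`, landed); ONE stacking on the shadow `33/10`-ball with surjectivity and injectivity
(`stub_oneStackingMap`); the real `3·nn_i`-ball inside it (`stub_realBall`); the rigid motion `g`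
(`stub_licence`); then the two-way `nn_i/6`-matching by rescaling the unit stacking to spacing `nn_i`. -/
theorem SoftLayerPropagation_of :
    Summit.AtomisticToContinuum.Crystallization.Theses.PricedLinkCensus.SoftLayerPropagation := by
  unfold Summit.AtomisticToContinuum.Crystallization.Theses.PricedLinkCensus.SoftLayerPropagation
  intro η hη hη1 N y i hcf
  -- the centre is charge-free, hence has positive scale
  have hci : IsChargeFree η y i := hcf i (by
    rw [dist_self]; exact mul_nonneg (by norm_num) (nearestDist_nonneg y i))
  have hpos : 0 < nearestDist y i := nearestDist_pos_of_isChargeFree hci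
  -- charts at every site of the hypothesis ball
  have charts := fun (j : Fin N) (hj : dist (y i) (y j) ≤ 8 * nearestDist y i) =>
    stub_chartAssembly stub_softLink stub_linkEdges η hη hη1 N y j (hcf j hj)
      (nearestDist_pos_of_isChargeFree (hcf j hj))
  -- the shadow crystal: development, one stacking, the real ball, the rigid motion
  obtain ⟨D, hD⟩ := stub_develop η hη hη1 N y i hpos hcf charts
  obtain ⟨s, φ, hs, hmem, hsurj, hinj⟩ := stub_oneStackingMap η hη hη1 N y i hpos hcf D hD
  have hreal := stub_realBall η hη hη1 N y i hpos hcf D φ s hD hs hmem hsurj hinj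
  obtain ⟨g, hg⟩ := stub_licence η hη hη1 N y i hpos hcf D φ s hD hs hmem hsurj hinj
  refine ⟨s, g, hs, ?_, ?_⟩
  · -- every site of the `3·nn_i`-ball is within `nn_i/6` of the rescaled shadow point
    intro j hj
    obtain ⟨hw, hd⟩ := hreal j hj
    exact ⟨nearestDist y i • φ (D j), smul_mem_barlowStacking (hmem j hw hd), hg j hw hd⟩
  · -- every stacking point of the `3·nn_i`-ball is within `nn_i/6` of a site
    intro z hz hzi
    obtain ⟨x, hx, rfl⟩ := exists_eq_smul_of_mem_barlowStacking hz
    -- the centre itself is matched, so `x` is within `19/6` of `φ (D i)`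
    have hwi : ∃ w : (bondGraph η y).Walk i i, w.length ≤ 5 := ⟨SimpleGraph.Walk.nil, by simp⟩
    have hdi : dist (D i) (D i) ≤ 33 / 10 := by rw [dist_self]; norm_num
    have hgi := hg i hwi hdi
    have hdist : dist (nearestDist y i • x) (nearestDist y i • φ (D i)) =
        nearestDist y i * dist x (φ (D i)) := by
      rw [dist_smul₀, Real.norm_eq_abs, abs_of_pos hpos]
    have hx13 : dist x (φ (D i)) ≤ 33 / 10 := by
      have h1 : dist (g (nearestDist y i • x)) (g (nearestDist y i • φ (D i))) ≤
          dist (g (nearestDist y i • x)) (y i) + dist (y i) (g (nearestDist y i • φ (D i))) :=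
        dist_triangle _ _ _
      rw [AffineIsometryEquiv.dist_map, hdist, dist_comm (g (nearestDist y i • x)) (y i)] at h1
      have h3 : nearestDist y i * dist x (φ (D i)) ≤ nearestDist y i * (19 / 6) := by linarith
      have h4 : dist x (φ (D i)) ≤ 19 / 6 := le_of_mul_le_mul_left h3 hpos
      linarith
    obtain ⟨j, hw, hd, hjx⟩ := hsurj x hx hx13
    refine ⟨j, ?_⟩
    have := hg j hw hd
    rwa [hjx] at this

end Summit.AtomisticToContinuum.Crystallization.Cruxes.SoftLayerPropagation.Sketch

end
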